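import Summits.CriticalPhenomena.PercolationContinuityZ3.Theorems.PercNearOneGluingNoHeavyConstsSingleEdgeValue
import Summits.CriticalPhenomena.PercolationContinuityZ3.Theorems.PercNearOneGluingNoHeavyConstsMDLXJointAvoidedMarker
import HarnessLib

/-!
# MDL(X)′ at the marker-pair functional `1{s(s,y) ∈ C_s}` in EVERY weighted graph: the primal cylinder at the pair `{s,y}`
# is the dual avoided-marker corner of van den Berg–Häggström–Kahn type (PAPER-2 track (ii); seat `prim-consts-2`, gen 17)

builds on p205010 (kernel theorem, internal audit signed; external expert review pending).  Support file (`--supports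
stmt-CriticalPhenomena-4575`); memo `run/shared/lean/prim/consts/FROM-prim-consts-2-g17-CYLINDER-DUALITY.md`.  No definitions, no named
facts, no sorries; standard axioms.

Notation (as in `…ConstsMDLXJoint.lean`): owner `s`, avoided set `X`, markers `y ≠ s`, `z`; `D = {s ↮ X}`, `𝒜 = {y ↮ {s}∪X}`, `T = 𝒜 ∩ D`,
`W = {y ↔ z}`, `Y = {s ↔ y}`, `Z = {s ↔ z}`, `A_y = {y ↮ X}`, `p' = μ(T∩W)/μ(T)`; `e = s(s,y)` the marker PAIR (a pair of weight `w e`,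
possibly `0`), `μ₀` the law with `e` switched off.

THE IDENTITY (pinning the pair `e`, `Consts.covD_pairOpen_eq` of gen 70/F7): for the single-pair cylinder functional `f = 1{e ∈ C_s}`
(`= 1{e open}`, the "pair form" PF of the lineage at the marker pair) the `Consts.MDLXJoint` margin factorises as

  `μ(T)·cov_D(f; Z) − μ(T∩W)·cov_D(f; Y) = w_e (1 − w_e)² · ( μ₀(T)·[μ₀(D)μ₀(D∩A_y∩Z) − μ₀(D∩A_y)μ₀(D∩Z)]`
  `                                                        − μ₀(T∩W)·[μ₀(D)μ₀(D∩A_y∩Y) − μ₀(D∩A_y)μ₀(D∩Y)] )`,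

i.e. the PRIMAL margin at the cylinder of the marker pair in `G` is `w_e(1−w_e)²` times the DUAL margin "J2 at `g = 1{y ↮ X}`" in `G − e`
(`Consts.mdlxJ2_at_yAvoid`, gen 12: the worlds in which the avoided cluster swallows `y` lose at `z` at least `p'` times the whole of `Y`).
Since the latter is a theorem for every weight function, in particular for `μ₀`:

* `Consts.mdlxJoint_markerPair` — **THEOREM: the `Consts.MDLXJoint` inequality holds at `F = 1{s(s,y) ∈ ·}` for every finite weighted graph,
  every avoided set `X` and all markers `y ≠ s`, `z`:**
  `μ(T∩W)·[μ(D)∫_{D∩Y} f − (∫_D f) μ(D∩Y)] ≤ μ(T)·[μ(D)∫_{D∩Z} f − (∫_D f) μ(D∩Z)]`.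
  For `X = ∅` this is the sharp instance of the tree's MDL(∅) (`CSH.cshMargin_nil_pairOpen_eq_zero`); for `X ≠ ∅` it was open (the pair form
  PF at a general pair `s(s,u)` stays open; exact census of the lineage: 0 violations).  It is also where the sharp constant of MDL(X)′ is
  attained in the exact census whenever `p_hi = p'` (gen 17 engine `eng/core17.py`: the minimising up-set is the marker-pair cylinder).
* helper set identities `Consts.markerPair_not_mem_of_mem_T` (on `T` the marker pair is closed), `Consts.avoidBoth_inter_reach_union_eq`
  (`{s,y ↮ X} ∩ ({s↔z} ∪ {y↔z}) = ({s,y ↮ X} ∩ {s↔z}) ⊔ (T ∩ W)`), `Consts.avoidBoth_eq_inter_reach_union_T` (`{s,y ↮ X} = ({s,y ↮ X} ∩ Y) ⊔ T`).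
[cite: VandenbergHaggstromKahn2005, Thm. 1.3 (p. 6), Thm. 1.4 (p. 7) with Remark 1 after Thm. 1.2 (p. 5)]
-/

noncomputable section

namespace Summit.CriticalPhenomena.PercolationContinuityZ3.Theorems

open MeasureTheory Set Literature.Probability.LatticeModels Literature.Probability.Percolation
open scoped Classical

namespace Consts

variable {V : Type*}

/-- On `T = {y ↮ {s}∪X} ∩ {s ↮ X}` the marker pair `s(s,y)` is closed (`s ≠ y`). [folklore] -/
theorem markerPair_not_mem_of_mem_T {s y : V} (hsy : s ≠ y) (X : Set V) {ω : BondConfig V}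
    (hω : ω ∈ {ω : BondConfig V | ∀ x ∈ insert s X, ¬ (openGraph ω).Reachable y x}) : s(s, y) ∉ ω := by
  intro he
  have hadj : (openGraph ω).Adj s y := (openGraph_adj ω s y).2 ⟨he, hsy⟩
  exact hω s (mem_insert s X) hadj.reachable.symm

/-- `{s ↮ X} ∩ {y ↮ X} ∩ ({s ↔ z} ∪ {y ↔ z})` is the DISJOINT union of `{s ↮ X} ∩ {y ↮ X} ∩ {s ↔ z}` and `T ∩ {y ↔ z}`
(`T = {y ↮ {s}∪X} ∩ {s ↮ X}`): on `{y ↔ z} ∖ {s ↔ z}` one has `y ↮ s`. [folklore] -/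
theorem avoidBoth_inter_reach_union_eq (s y z : V) (X : Set V) :
    {ω : BondConfig V | ∀ x ∈ X, ¬ (openGraph ω).Reachable s x ∧ ¬ (openGraph ω).Reachable y x} ∩ (openConn s z ∪ openConn y z) =
      ({ω : BondConfig V | ∀ x ∈ X, ¬ (openGraph ω).Reachable s x ∧ ¬ (openGraph ω).Reachable y x} ∩ openConn s z) ∪
        ({ω : BondConfig V | ∀ x ∈ insert s X, ¬ (openGraph ω).Reachable y x} ∩
          {ω | ∀ x ∈ X, ¬ (openGraph ω).Reachable s x} ∩ openConn y z) := by
  ext ω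
  simp only [mem_inter_iff, mem_union, mem_setOf_eq, openConn, mem_insert_iff, forall_eq_or_imp]
  constructor
  · rintro ⟨hD₁, hZ | hW⟩
    · exact Or.inl ⟨hD₁, hZ⟩
    · by_cases hZ : (openGraph ω).Reachable s z
      · exact Or.inl ⟨hD₁, hZ⟩
      · refine Or.inr ⟨⟨⟨fun hys => hZ (hys.symm.trans hW), fun x hx => (hD₁ x hx).2⟩, fun x hx => (hD₁ x hx).1⟩, hW⟩
  · rintro (⟨hD₁, hZ⟩ | ⟨⟨⟨_, hAX⟩, hD⟩, hW⟩)
    · exact ⟨hD₁, Or.inl hZ⟩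
    · exact ⟨fun x hx => ⟨hD x hx, hAX x hx⟩, Or.inr hW⟩

/-- The two pieces of `Consts.avoidBoth_inter_reach_union_eq` are disjoint. [folklore] -/
theorem disjoint_avoidBoth_reach_T (s y z : V) (X : Set V) :
    Disjoint ({ω : BondConfig V | ∀ x ∈ X, ¬ (openGraph ω).Reachable s x ∧ ¬ (openGraph ω).Reachable y x} ∩ openConn s z)
      ({ω : BondConfig V | ∀ x ∈ insert s X, ¬ (openGraph ω).Reachable y x} ∩
        {ω | ∀ x ∈ X, ¬ (openGraph ω).Reachable s x} ∩ openConn y z) := by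
  rw [Set.disjoint_left]
  rintro ω ⟨-, hZ⟩ ⟨⟨hA, -⟩, hW⟩
  exact hA s (mem_insert s X) ((hW : (openGraph ω).Reachable y z).trans (hZ : (openGraph ω).Reachable s z).symm)

/-- `{s ↮ X} ∩ {y ↮ X}` is the DISJOINT union of `{s ↮ X} ∩ {y ↮ X} ∩ {s ↔ y}` and `T = {y ↮ {s}∪X} ∩ {s ↮ X}`. [folklore] -/
theorem avoidBoth_eq_inter_reach_union_T (s y : V) (X : Set V) :
    {ω : BondConfig V | ∀ x ∈ X, ¬ (openGraph ω).Reachable s x ∧ ¬ (openGraph ω).Reachable y x} =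
      ({ω : BondConfig V | ∀ x ∈ X, ¬ (openGraph ω).Reachable s x ∧ ¬ (openGraph ω).Reachable y x} ∩ openConn s y) ∪
        ({ω : BondConfig V | ∀ x ∈ insert s X, ¬ (openGraph ω).Reachable y x} ∩
          {ω | ∀ x ∈ X, ¬ (openGraph ω).Reachable s x}) := by
  ext ω
  simp only [mem_inter_iff, mem_union, mem_setOf_eq, openConn, mem_insert_iff, forall_eq_or_imp]
  constructor
  · intro hD₁
    by_cases hY : (openGraph ω).Reachable s y
    · exact Or.inl ⟨hD₁, hY⟩
    · exact Or.inr ⟨⟨fun hys => hY hys.symm, fun x hx => (hD₁ x hx).2⟩, fun x hx => (hD₁ x hx).1⟩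
  · rintro (⟨hD₁, _⟩ | ⟨⟨_, hAX⟩, hD⟩)
    · exact hD₁
    · exact fun x hx => ⟨hD x hx, hAX x hx⟩

/-- The two pieces of `Consts.avoidBoth_eq_inter_reach_union_T` are disjoint. [folklore] -/
theorem disjoint_avoidBoth_reachY_T (s y : V) (X : Set V) :
    Disjoint ({ω : BondConfig V | ∀ x ∈ X, ¬ (openGraph ω).Reachable s x ∧ ¬ (openGraph ω).Reachable y x} ∩ openConn s y)
      ({ω : BondConfig V | ∀ x ∈ insert s X, ¬ (openGraph ω).Reachable y x} ∩
        {ω | ∀ x ∈ X, ¬ (openGraph ω).Reachable s x}) := by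
  rw [Set.disjoint_left]
  rintro ω ⟨-, hY⟩ ⟨hA, -⟩
  exact hA s (mem_insert s X) (hY : (openGraph ω).Reachable s y).symm

/-- `{s ↮ X} ∩ {y ↮ X}` written with a conjunction equals the intersection of the two avoidance events. [folklore] -/
theorem avoidBoth_eq_inter (s y : V) (X : Set V) :
    {ω : BondConfig V | ∀ x ∈ X, ¬ (openGraph ω).Reachable s x ∧ ¬ (openGraph ω).Reachable y x} =
      {ω : BondConfig V | ∀ x ∈ X, ¬ (openGraph ω).Reachable s x} ∩ {ω | ∀ x ∈ X, ¬ (openGraph ω).Reachable y x} := by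
  ext ω
  simp only [mem_setOf_eq, mem_inter_iff]
  exact ⟨fun h => ⟨fun x hx => (h x hx).1, fun x hx => (h x hx).2⟩, fun h x hx => ⟨h.1 x hx, h.2 x hx⟩⟩

variable [Fintype V]

/-- **Pinning the marker pair CLOSED on an event contained in `{e ∉ ω}`**: if `s(s,y) ∉ ω` for every `ω ∈ S`, then
`μ(S) = (1 − w_e) · μ₀(S)` with `μ₀` the law in which `e = s(s,y)` is switched off. [folklore] -/
theorem measureReal_eq_of_pair_not_mem (w : Sym2 V → unitInterval) (e : Sym2 V) (S : Set (BondConfig V))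
    (hS : ∀ ω ∈ S, e ∉ ω) :
    (prodBernoulli w).real S = (1 - (w e : ℝ)) * (prodBernoulli fun d => if d = e then 0 else w d).real S := by
  classical
  have hmeas : MeasurableSet S := MeasurableSet.of_discrete
  have key := CSH.integral_indicator_not_mem_mul w e (S.indicator 1)
  have hpt : ∀ ω : BondConfig V, (if e ∈ ω then (0 : ℝ) else 1) * S.indicator 1 ω = S.indicator 1 ω := by
    intro ω
    by_cases hω : ω ∈ S
    · rw [if_neg (hS ω hω), one_mul]
    · rw [Set.indicator_of_notMem hω, mul_zero]
  simp_rw [hpt] at key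
  rw [integral_indicator_one hmeas, integral_indicator_one hmeas] at key
  exact key

/-- **MDL(X)′ AT THE MARKER-PAIR FUNCTIONAL, every weighted graph.**  For all weights `w`, owner `s`, avoided set `X`, markers `y ≠ s`
and `z`, the `Consts.MDLXJoint` inequality holds at the single-pair cylinder functional `F = 1{s(s,y) ∈ ·}` of the open edge cluster of `s`:
`μ(T∩W)·[μ(D)∫_{D∩Y} F(C_s) − (∫_D F(C_s))·μ(D∩Y)] ≤ μ(T)·[μ(D)∫_{D∩Z} F(C_s) − (∫_D F(C_s))·μ(D∩Z)]`.
Proof: pin the pair (`Consts.covD_pairOpen_eq`, `Consts.measureReal_eq_of_pair_not_mem`); the margin is `w_e(1−w_e)²` times the J2 margin of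
`Consts.mdlxJ2_at_yAvoid` for the law with the pair switched off.
[cite: VandenbergHaggstromKahn2005, Thm. 1.3 (p. 6), Thm. 1.4 (p. 7) with Remark 1 after Thm. 1.2 (p. 5)] -/
theorem mdlxJoint_markerPair (w : Sym2 V → unitInterval) (s y z : V) (X : Set V) (hsy : s ≠ y) :
    (prodBernoulli w).real ({ω : BondConfig V | ∀ x ∈ insert s X, ¬ (openGraph ω).Reachable y x} ∩
          {ω | ∀ x ∈ X, ¬ (openGraph ω).Reachable s x} ∩ openConn y z) *
        ((prodBernoulli w).real {ω : BondConfig V | ∀ x ∈ X, ¬ (openGraph ω).Reachable s x} *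
            (∫ ω in {ω : BondConfig V | ∀ x ∈ X, ¬ (openGraph ω).Reachable s x} ∩ openConn s y,
              (fun C : Set (Sym2 V) => if s(s, y) ∈ C then (1 : ℝ) else 0) (openEdgeCluster ω s) ∂(prodBernoulli w)) -
          (∫ ω in {ω : BondConfig V | ∀ x ∈ X, ¬ (openGraph ω).Reachable s x},
              (fun C : Set (Sym2 V) => if s(s, y) ∈ C then (1 : ℝ) else 0) (openEdgeCluster ω s) ∂(prodBernoulli w)) *
            (prodBernoulli w).real ({ω : BondConfig V | ∀ x ∈ X, ¬ (openGraph ω).Reachable s x} ∩ openConn s y)) ≤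
      (prodBernoulli w).real ({ω : BondConfig V | ∀ x ∈ insert s X, ¬ (openGraph ω).Reachable y x} ∩
          {ω | ∀ x ∈ X, ¬ (openGraph ω).Reachable s x}) *
        ((prodBernoulli w).real {ω : BondConfig V | ∀ x ∈ X, ¬ (openGraph ω).Reachable s x} *
            (∫ ω in {ω : BondConfig V | ∀ x ∈ X, ¬ (openGraph ω).Reachable s x} ∩ openConn s z,
              (fun C : Set (Sym2 V) => if s(s, y) ∈ C then (1 : ℝ) else 0) (openEdgeCluster ω s) ∂(prodBernoulli w)) -
          (∫ ω in {ω : BondConfig V | ∀ x ∈ X, ¬ (openGraph ω).Reachable s x},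
              (fun C : Set (Sym2 V) => if s(s, y) ∈ C then (1 : ℝ) else 0) (openEdgeCluster ω s) ∂(prodBernoulli w)) *
            (prodBernoulli w).real ({ω : BondConfig V | ∀ x ∈ X, ¬ (openGraph ω).Reachable s x} ∩ openConn s z)) := by
  classical
  -- the two covariance brackets ARE `CSH.covD w s X f y` and `CSH.covD w s X f z`
  change (prodBernoulli w).real _ * CSH.covD w s X (fun C : Set (Sym2 V) => if s(s, y) ∈ C then (1 : ℝ) else 0) y ≤
    (prodBernoulli w).real _ * CSH.covD w s X (fun C : Set (Sym2 V) => if s(s, y) ∈ C then (1 : ℝ) else 0) z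
  rw [covD_pairOpen_eq w s y y X hsy, covD_pairOpen_eq w s y z X hsy]
  have hmeas : ∀ S : Set (BondConfig V), MeasurableSet S := fun _ => MeasurableSet.of_discrete
  -- `{s ↔ y} ∪ {y ↔ y}` is everything
  have huniv : openConn s y ∪ openConn y y = (univ : Set (BondConfig V)) := by
    refine eq_univ_of_forall fun ω => Or.inr ?_
    exact (SimpleGraph.Reachable.refl y : (openGraph ω).Reachable y y)
  rw [huniv, inter_univ]
  -- pin the pair on `T ∩ W` and on `T`
  rw [measureReal_eq_of_pair_not_mem w s(s, y)
      ({ω : BondConfig V | ∀ x ∈ insert s X, ¬ (openGraph ω).Reachable y x} ∩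
        {ω | ∀ x ∈ X, ¬ (openGraph ω).Reachable s x} ∩ openConn y z) (fun ω hω => markerPair_not_mem_of_mem_T hsy X hω.1.1),
    measureReal_eq_of_pair_not_mem w s(s, y)
      ({ω : BondConfig V | ∀ x ∈ insert s X, ¬ (openGraph ω).Reachable y x} ∩
        {ω | ∀ x ∈ X, ¬ (openGraph ω).Reachable s x}) (fun ω hω => markerPair_not_mem_of_mem_T hsy X hω.1)]
  -- set bookkeeping under the pinned law `μ₀`
  have hsplitZ : (prodBernoulli fun d => if d = s(s, y) then 0 else w d).real
        ({ω : BondConfig V | ∀ x ∈ X, ¬ (openGraph ω).Reachable s x ∧ ¬ (openGraph ω).Reachable y x} ∩ (openConn s z ∪ openConn y z)) =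
      (prodBernoulli fun d => if d = s(s, y) then 0 else w d).real
          ({ω : BondConfig V | ∀ x ∈ X, ¬ (openGraph ω).Reachable s x ∧ ¬ (openGraph ω).Reachable y x} ∩ openConn s z) +
        (prodBernoulli fun d => if d = s(s, y) then 0 else w d).real
          ({ω : BondConfig V | ∀ x ∈ insert s X, ¬ (openGraph ω).Reachable y x} ∩
            {ω | ∀ x ∈ X, ¬ (openGraph ω).Reachable s x} ∩ openConn y z) := by
    rw [avoidBoth_inter_reach_union_eq s y z X]
    exact measureReal_union (disjoint_avoidBoth_reach_T s y z X) (hmeas _)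
  have hsplitY : (prodBernoulli fun d => if d = s(s, y) then 0 else w d).real
        {ω : BondConfig V | ∀ x ∈ X, ¬ (openGraph ω).Reachable s x ∧ ¬ (openGraph ω).Reachable y x} =
      (prodBernoulli fun d => if d = s(s, y) then 0 else w d).real
          ({ω : BondConfig V | ∀ x ∈ X, ¬ (openGraph ω).Reachable s x ∧ ¬ (openGraph ω).Reachable y x} ∩ openConn s y) +
        (prodBernoulli fun d => if d = s(s, y) then 0 else w d).real
          ({ω : BondConfig V | ∀ x ∈ insert s X, ¬ (openGraph ω).Reachable y x} ∩
            {ω | ∀ x ∈ X, ¬ (openGraph ω).Reachable s x}) := by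
    conv_lhs => rw [avoidBoth_eq_inter_reach_union_T s y X]
    exact measureReal_union (disjoint_avoidBoth_reachY_T s y X) (hmeas _)
  rw [hsplitZ]
  -- the dual corner J2 at `g = 1{y ↮ X}` for the law with the pair switched off
  have key := mdlxJ2_at_yAvoid (fun d => if d = s(s, y) then 0 else w d) s y z X
  rw [← avoidBoth_eq_inter s y X] at key
  -- abbreviate the eight masses and the weight of the pair
  set μ₀ := prodBernoulli (fun d => if d = s(s, y) then 0 else w d) with hμ₀
  set q : ℝ := (w s(s, y) : ℝ) with hq
  set tw := μ₀.real ({ω : BondConfig V | ∀ x ∈ insert s X, ¬ (openGraph ω).Reachable y x} ∩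
    {ω | ∀ x ∈ X, ¬ (openGraph ω).Reachable s x} ∩ openConn y z) with htw
  set t := μ₀.real ({ω : BondConfig V | ∀ x ∈ insert s X, ¬ (openGraph ω).Reachable y x} ∩
    {ω | ∀ x ∈ X, ¬ (openGraph ω).Reachable s x}) with ht
  set d := μ₀.real {ω : BondConfig V | ∀ x ∈ X, ¬ (openGraph ω).Reachable s x} with hd
  set d1 := μ₀.real {ω : BondConfig V | ∀ x ∈ X, ¬ (openGraph ω).Reachable s x ∧ ¬ (openGraph ω).Reachable y x} with hd1
  set d1Y := μ₀.real ({ω : BondConfig V | ∀ x ∈ X, ¬ (openGraph ω).Reachable s x ∧ ¬ (openGraph ω).Reachable y x} ∩ openConn s y)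
    with hd1Y
  set d1Z := μ₀.real ({ω : BondConfig V | ∀ x ∈ X, ¬ (openGraph ω).Reachable s x ∧ ¬ (openGraph ω).Reachable y x} ∩ openConn s z)
    with hd1Z
  set dY := μ₀.real ({ω : BondConfig V | ∀ x ∈ X, ¬ (openGraph ω).Reachable s x} ∩ openConn s y) with hdY
  set dZ := μ₀.real ({ω : BondConfig V | ∀ x ∈ X, ¬ (openGraph ω).Reachable s x} ∩ openConn s z) with hdZ
  -- nonnegativity of the pinning factor `q (1 - q)²`
  have hq0 : 0 ≤ q := (w s(s, y)).2.1
  have hq1 : q ≤ 1 := (w s(s, y)).2.2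
  have hfac : 0 ≤ q * (1 - q) * (1 - q) := mul_nonneg (mul_nonneg hq0 (by linarith)) (by linarith)
  have key' := mul_le_mul_of_nonneg_left key hfac
  linear_combination key' + (q * (1 - q) * (1 - q) * tw * d) * hsplitY

end Consts

end Summit.CriticalPhenomena.PercolationContinuityZ3.Theorems

end
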